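import Summits.Ventures.PackingBounds.SphericalCodes.DegreeThreeEquality

/-!
# Equality in a quartic LP certificate: the 2-design identity per point and the valency equations

Framing: lottery ticket; floor = certified bounds/negative ranges. Venture `PackingBounds`
(cell `pub-packcert`), spherical-code family; STRUCTURE lemma behind the `L₄ − 1` rows of the cell's
standard-angle grid (cells whose certified Delsarte value is an integer realised by a quartic
certificate `(t + 1)(t - s)(t + b)²`, but whose forced valencies are not natural numbers).

**Theorem (equality case, degree-two design half; Delsarte–Goethals–Seidel 1977 §4).** If a code
`C ⊂ S^{n-1}` with pairwise inner products `≤ s` attains the LP bound `|C| f_0 = f(1)` for an admissible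
`f` with `f_2 > 0`, then `Σ_{x,y ∈ C} C_2^{μ}(⟨x,y⟩) = 0`, i.e. `Σ_{x,y} ⟨x,y⟩² = |C|²/n`; writing
`M = Σ_{y ∈ C} y yᵀ` this is `‖M‖_F² = (tr M)²/n`, which forces `M = (|C|/n)·I`, hence
`Σ_{y ∈ C} ⟨x,y⟩² = |C|/n` for EVERY unit vector `x` (`sum_inner_sq_eq_of_card_mul_eq`). With the
balanced-code identity of `DegreeThreeEquality` (`f_1 > 0`) and the root structure of
`f = (t+1)(t-s)(t+b)²`, every point of a sharp code has valencies `m = #{y = -x} ≤ 1`,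
`A = #{⟨x,y⟩ = s}`, `B = #{⟨x,y⟩ = -b}` with `m + A + B + 1 = |C|`, `1 - m + sA - bB = 0`,
`1 + m + s²A + b²B = |C|/n` (`degree_four_valency`); if no natural numbers satisfy these, then
`A(n, s) ≤ f(1)/f_0 - 1` (`degree_four_card_le_of_no_valency`). Prior art for the phenomenon: codes
attaining the even Levenshtein bounds do not exist beyond the nodes (Boyvalenkov–Danev–Landgev 1999).

## References
* P. Delsarte, J. M. Goethals, J. J. Seidel, *Spherical codes and designs*, Geom. Dedicata 6 (1977)
  363–388, §4. [`DelsarteGoethalsSeidel1977`]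
* P. Boyvalenkov, D. Danev, I. Landgev, *On maximal spherical codes II*, J. Combin. Des. 7 (1999)
  316–326.
-/

noncomputable section

namespace Summit.Ventures.PackingBounds.SphericalCodes

open Finset Literature.Analysis.SpecialFunctions Literature.Geometry.DiscreteGeometry
open scoped RealInnerProductSpace

/-- **Per-point 2-design identity at an LP-sharp code (coordinate form).** Unit vectors
`x_a : Fin n → ℝ` (`n = 2μ+2`, `μ > 0`) with pairwise `Σ_j x_{a,j} x_{b,j} ≤ s` attaining the LP bound
for an admissible `f` of degree `d ≥ 2` with `f_2 > 0` satisfy, for every index `a`,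
`Σ_b (Σ_j x_{a,j} x_{b,j})² = (#points)/n`. (Design half of complementary slackness, degree 2:
`Σ_{a,b} C_2^{μ} = 0` gives `‖M‖_F² = (tr M)²/n` for `M = Σ_b x_b x_bᵀ`, hence `M = (#points/n)·I`.)
(Delsarte–Goethals–Seidel 1977 §4.) -/
theorem sum_dot_sq_eq_of_card_mul_eq_coord {n : ℕ} {μ : ℝ} (hn : (n : ℝ) = 2 * μ + 2) (hμ : 0 < μ)
    (d : ℕ) (f : ℕ → ℝ) (hf : ∀ k, 0 ≤ f k) (s : ℝ)
    (hF : ∀ t : ℝ, -1 ≤ t → t ≤ s → ∑ k ∈ range (d + 1), f k * gegenbauerSum μ k t ≤ 0)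
    {ι : Type*} [Fintype ι] (x : ι → Fin n → ℝ)
    (hunit : ∀ a, ∑ j, x a j ^ 2 = 1) (hsep : ∀ a b, a ≠ b → ∑ j, x a j * x b j ≤ s)
    (heq : (Fintype.card ι : ℝ) * f 0 = ∑ k ∈ range (d + 1), f k * gegenbauerSum μ k 1)
    (hd : 2 ≤ d) (hf2 : 0 < f 2) (a : ι) :
    ∑ b, (∑ j, x a j * x b j) ^ 2 = (Fintype.card ι : ℝ) / n := by
  classical
  have key := DelsarteLP.sum_sum_gegenbauerSum_eq_zero_of_card_mul_eq_coord hn hμ d f hf s hF x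
    hunit hsep heq (k := 2) (Finset.mem_range.2 (by omega)) (by norm_num) hf2
  have hC2 : ∀ t : ℝ, gegenbauerSum μ 2 t = 2 * μ * (μ + 1) * t ^ 2 - μ := by
    intro t
    simp [gegenbauerSum, gegenbauerCoeff, Finset.sum_range_succ, Finset.prod_range_succ,
      Nat.factorial]
    ring
  simp only [hC2] at key
  set N : ℝ := (Fintype.card ι : ℝ) with hN
  have hn0 : (n : ℝ) ≠ 0 := by rw [hn]; positivity
  have hμ1 : (0 : ℝ) < μ + 1 := by linarith
  -- (1) the total second moment: `Σ_{a,b} ip² = N²/n`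
  set ip : ι → ι → ℝ := fun a b => ∑ j, x a j * x b j with hip
  have hS : ∑ a, ∑ b, ip a b ^ 2 = N ^ 2 / n := by
    have e1 : ∀ a, ∑ b, (2 * μ * (μ + 1) * ip a b ^ 2 - μ) =
        2 * μ * (μ + 1) * ∑ b, ip a b ^ 2 - N * μ := fun a => by
      rw [Finset.sum_sub_distrib, Finset.sum_const, Finset.card_univ, nsmul_eq_mul, ← Finset.mul_sum]
    have e2 : ∑ a, ∑ b, (2 * μ * (μ + 1) * ip a b ^ 2 - μ) =
        2 * μ * (μ + 1) * ∑ a, ∑ b, ip a b ^ 2 - N * (N * μ) := by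
      rw [Finset.sum_congr rfl fun a _ => e1 a, Finset.sum_sub_distrib, Finset.sum_const,
        Finset.card_univ, nsmul_eq_mul, ← Finset.mul_sum]
    have h0 : 2 * μ * (μ + 1) * ∑ a, ∑ b, ip a b ^ 2 - N * (N * μ) = 0 := by
      rw [← e2]; exact key
    rw [hn]
    field_simp
    nlinarith [h0, hμ]
  -- (2) the moment matrix `M_{ij} = Σ_a x_{a,i} x_{a,j}`
  set M : Fin n → Fin n → ℝ := fun i j => ∑ c, x c i * x c j with hM
  have hquad : ∀ a b, ip a b ^ 2 = ∑ i, ∑ j, (x a i * x a j) * (x b i * x b j) := fun a b => by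
    rw [hip, sq, Finset.sum_mul_sum]
    exact Finset.sum_congr rfl fun i _ => Finset.sum_congr rfl fun j _ => by ring
  have hSM : ∑ a, ∑ b, ip a b ^ 2 = ∑ i, ∑ j, M i j ^ 2 := by
    calc ∑ a, ∑ b, ip a b ^ 2 = ∑ a, ∑ b, ∑ i, ∑ j, (x a i * x a j) * (x b i * x b j) :=
          Finset.sum_congr rfl fun a _ => Finset.sum_congr rfl fun b _ => hquad a b
      _ = ∑ a, ∑ i, ∑ b, ∑ j, (x a i * x a j) * (x b i * x b j) :=
          Finset.sum_congr rfl fun a _ => Finset.sum_comm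
      _ = ∑ a, ∑ i, ∑ j, ∑ b, (x a i * x a j) * (x b i * x b j) :=
          Finset.sum_congr rfl fun a _ => Finset.sum_congr rfl fun i _ => Finset.sum_comm
      _ = ∑ i, ∑ a, ∑ j, ∑ b, (x a i * x a j) * (x b i * x b j) := Finset.sum_comm
      _ = ∑ i, ∑ j, ∑ a, ∑ b, (x a i * x a j) * (x b i * x b j) :=
          Finset.sum_congr rfl fun i _ => Finset.sum_comm
      _ = ∑ i, ∑ j, M i j ^ 2 := by
          refine Finset.sum_congr rfl fun i _ => Finset.sum_congr rfl fun j _ => ?_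
          rw [hM, sq, Finset.sum_mul_sum]
  have htr : ∑ i, M i i = N := by
    calc ∑ i, M i i = ∑ i, ∑ c, x c i * x c i := rfl
      _ = ∑ c, ∑ i, x c i * x c i := Finset.sum_comm
      _ = ∑ c, (1 : ℝ) := Finset.sum_congr rfl fun c _ => by
          rw [← hunit c]; exact Finset.sum_congr rfl fun i _ => by ring
      _ = N := by simp [hN]
  have hMsq : ∑ i, ∑ j, M i j ^ 2 = N ^ 2 / n := by rw [← hSM]; exact hS
  have hsplit : ∑ i, ∑ j, M i j ^ 2 = ∑ i, M i i ^ 2 + ∑ i, ∑ j ∈ univ.erase i, M i j ^ 2 := by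
    rw [← Finset.sum_add_distrib]
    exact Finset.sum_congr rfl fun i _ => (Finset.add_sum_erase _ _ (Finset.mem_univ i)).symm
  have hcardn : (Finset.univ : Finset (Fin n)).card = n := by simp
  have hvar : ∑ i, (M i i - N / n) ^ 2 = ∑ i, M i i ^ 2 - N ^ 2 / n := by
    calc ∑ i, (M i i - N / n) ^ 2 = ∑ i, (M i i ^ 2 - 2 * (N / n) * M i i + (N / n) ^ 2) :=
          Finset.sum_congr rfl fun i _ => by ring
      _ = ∑ i, M i i ^ 2 - 2 * (N / n) * ∑ i, M i i + (n : ℝ) * (N / n) ^ 2 := by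
          rw [Finset.sum_add_distrib, Finset.sum_sub_distrib, Finset.sum_const, hcardn, nsmul_eq_mul,
            ← Finset.mul_sum]
      _ = ∑ i, M i i ^ 2 - N ^ 2 / n := by
          rw [htr]; field_simp; ring
  have hoffnn : 0 ≤ ∑ i, ∑ j ∈ univ.erase i, M i j ^ 2 :=
    Finset.sum_nonneg fun i _ => Finset.sum_nonneg fun j _ => sq_nonneg _
  have hvarnn : 0 ≤ ∑ i, (M i i - N / n) ^ 2 := Finset.sum_nonneg fun i _ => sq_nonneg _
  have hoff0 : ∑ i, ∑ j ∈ univ.erase i, M i j ^ 2 = 0 := by linarith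
  have hvar0 : ∑ i, (M i i - N / n) ^ 2 = 0 := by linarith
  have hdiag : ∀ i, M i i = N / n := fun i => by
    have := (Finset.sum_eq_zero_iff_of_nonneg fun i _ => sq_nonneg (M i i - N / n)).1 hvar0 i
      (Finset.mem_univ i)
    have h := pow_eq_zero_iff (n := 2) (by norm_num) |>.1 this
    linarith
  have hoff : ∀ i, ∀ j ∈ univ.erase i, M i j = 0 := fun i j hj => by
    have hi := (Finset.sum_eq_zero_iff_of_nonneg fun i _ =>
      Finset.sum_nonneg fun j _ => sq_nonneg (M i j)).1 hoff0 i (Finset.mem_univ i)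
    have := (Finset.sum_eq_zero_iff_of_nonneg fun j _ => sq_nonneg (M i j)).1 hi j hj
    exact pow_eq_zero_iff (n := 2) (by norm_num) |>.1 this
  -- (3) the point `a`: `Σ_b ip(a,b)² = Σ_{i,j} x_{a,i} x_{a,j} M_{ij} = (N/n) Σ_i x_{a,i}²`
  calc ∑ b, ip a b ^ 2 = ∑ b, ∑ i, ∑ j, (x a i * x a j) * (x b i * x b j) :=
        Finset.sum_congr rfl fun b _ => hquad a b
    _ = ∑ i, ∑ b, ∑ j, (x a i * x a j) * (x b i * x b j) := Finset.sum_comm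
    _ = ∑ i, ∑ j, ∑ b, (x a i * x a j) * (x b i * x b j) :=
        Finset.sum_congr rfl fun i _ => Finset.sum_comm
    _ = ∑ i, ∑ j, (x a i * x a j) * M i j := by
        refine Finset.sum_congr rfl fun i _ => Finset.sum_congr rfl fun j _ => ?_
        rw [hM, Finset.mul_sum]
    _ = ∑ i, (x a i * x a i) * M i i := by
        refine Finset.sum_congr rfl fun i _ => ?_
        rw [← Finset.add_sum_erase _ _ (Finset.mem_univ i)]
        have : ∑ j ∈ univ.erase i, (x a i * x a j) * M i j = 0 :=
          Finset.sum_eq_zero fun j hj => by rw [hoff i j hj, mul_zero]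
        rw [this, add_zero]
    _ = (N / n) * ∑ i, x a i ^ 2 := by
        rw [Finset.mul_sum]; exact Finset.sum_congr rfl fun i _ => by rw [hdiag i]; ring
    _ = N / n := by rw [hunit a, mul_one]

/-- **Per-point 2-design identity at an LP-sharp code** (`Finset` form): if `C ⊂ S^{n-1}` with pairwise
inner products `≤ s` attains the LP bound for an admissible `f` of degree `d ≥ 2` with `f_2 > 0`,
then `Σ_{y ∈ C} ⟨x,y⟩² = |C|/n` for every `x ∈ C` (indeed `Σ_{y ∈ C} y yᵀ = (|C|/n)·I`).
(Delsarte–Goethals–Seidel 1977 §4: LP-sharp codes with `f_2 > 0` are 2-designs.) -/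
theorem sum_inner_sq_eq_of_card_mul_eq {n : ℕ} {μ : ℝ} (hn : (n : ℝ) = 2 * μ + 2) (hμ : 0 < μ)
    (d : ℕ) (f : ℕ → ℝ) (hf : ∀ k, 0 ≤ f k) (s : ℝ)
    (hF : ∀ t : ℝ, -1 ≤ t → t ≤ s → ∑ k ∈ range (d + 1), f k * gegenbauerSum μ k t ≤ 0)
    (C : Finset (EuclideanSpace ℝ (Fin n))) (h1 : ∀ x ∈ C, ‖x‖ = 1)
    (h2 : ∀ x ∈ C, ∀ y ∈ C, x ≠ y → inner ℝ x y ≤ s)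
    (heq : (C.card : ℝ) * f 0 = ∑ k ∈ range (d + 1), f k * gegenbauerSum μ k 1)
    (hd : 2 ≤ d) (hf2 : 0 < f 2) {x : EuclideanSpace ℝ (Fin n)} (hx : x ∈ C) :
    ∑ y ∈ C, inner ℝ x y ^ 2 = (C.card : ℝ) / n := by
  classical
  have hinner : ∀ a b : EuclideanSpace ℝ (Fin n), inner ℝ a b = ∑ j, a j * b j := fun a b => by
    simp [PiLp.inner_apply, mul_comm]
  set xs : C → Fin n → ℝ := fun a j => (a : EuclideanSpace ℝ (Fin n)) j with hxs
  have hunit : ∀ a : C, ∑ j, xs a j ^ 2 = 1 := fun a => by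
    rw [← EuclideanSpace.real_norm_sq_eq, h1 a a.2, one_pow]
  have hsep : ∀ a b : C, a ≠ b → ∑ j, xs a j * xs b j ≤ s := fun a b hab => by
    have hne : (a : EuclideanSpace ℝ (Fin n)) ≠ b := fun h => hab (Subtype.ext h)
    have h := h2 a a.2 b b.2 hne
    rwa [hinner] at h
  have heq' : (Fintype.card C : ℝ) * f 0 = ∑ k ∈ range (d + 1), f k * gegenbauerSum μ k 1 := by
    simpa [Fintype.card_coe] using heq
  have key := sum_dot_sq_eq_of_card_mul_eq_coord hn hμ d f hf s hF xs hunit hsep heq' hd hf2 ⟨x, hx⟩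
  rw [Fintype.card_coe] at key
  calc ∑ y ∈ C, inner ℝ x y ^ 2 = ∑ b : C, inner ℝ x (b : EuclideanSpace ℝ (Fin n)) ^ 2 :=
        (Finset.sum_coe_sort C (fun y => inner ℝ x y ^ 2)).symm
    _ = ∑ b : C, (∑ j, xs ⟨x, hx⟩ j * xs b j) ^ 2 :=
        Finset.sum_congr rfl fun b _ => by rw [hinner]
    _ = (C.card : ℝ) / n := key

/-- Two unit vectors with inner product `-1` are antipodal. [folklore] -/
theorem eq_neg_of_inner_eq_neg_one {n : ℕ} {x y : EuclideanSpace ℝ (Fin n)} (hx : ‖x‖ = 1)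
    (hy : ‖y‖ = 1) (h : inner ℝ x y = -1) : y = -x := by
  have h0 : ‖x + y‖ ^ 2 = 0 := by
    rw [norm_add_sq_real, hx, hy, h]; ring
  have h1 : x + y = 0 := by
    have := pow_eq_zero_iff (n := 2) (by norm_num) |>.1 h0
    exact norm_eq_zero.1 this
  exact eq_neg_of_add_eq_zero_right h1

/-- **Valency equations at a sharp quartic certificate.** Let `f = Σ_{k ≤ 4} f_k C_k^{μ}` with
`f_k ≥ 0`, `f_1 > 0`, `f_2 > 0` factor as `f(t) = (t + 1)(t - s)(t + b)²` with `s ≠ -b`, `b ≠ 1`,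
`-1 < s` (`n = 2μ+2`, `μ > 0`), and let `C ⊂ S^{n-1}` with pairwise inner products `≤ s` attain the
bound `|C| f_0 = f(1)`. Then for every `x ∈ C`, with `m = #{y ∈ C : y = -x} ≤ 1`,
`A = #{y : ⟨x,y⟩ = s}`, `B = #{y : ⟨x,y⟩ = -b}` (over `C ∖ {x}`):
`m + A + B + 1 = |C|`, `1 - m + s·A - b·B = 0` (balanced) and `1 + m + s²·A + b²·B = |C|/n`
(2-design). (Equality case of the Delsarte–Goethals–Seidel bound for a quartic certificate.) -/
theorem degree_four_valency {n : ℕ} {μ : ℝ} (hnμ : (n : ℝ) = 2 * μ + 2) (hμ : 0 < μ)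
    (s b : ℝ) (hsb : s ≠ -b) (hb1 : b ≠ 1) (hs1 : -1 < s) (f : ℕ → ℝ) (hf : ∀ k, 0 ≤ f k)
    (hf1 : 0 < f 1) (hf2 : 0 < f 2)
    (hfac : ∀ t : ℝ, ∑ k ∈ range (4 + 1), f k * gegenbauerSum μ k t = (t + 1) * (t - s) * (t + b) ^ 2)
    (C : Finset (EuclideanSpace ℝ (Fin n)))
    (h1 : ∀ x ∈ C, ‖x‖ = 1) (h2 : ∀ x ∈ C, ∀ y ∈ C, x ≠ y → inner ℝ x y ≤ s)
    (heq : (C.card : ℝ) * f 0 = 2 * (1 - s) * (1 + b) ^ 2)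
    {x : EuclideanSpace ℝ (Fin n)} (hx : x ∈ C) :
    ((C.erase x).filter fun y => inner ℝ x y = -1).card ≤ 1 ∧
    ((C.erase x).filter fun y => inner ℝ x y = -1).card
        + ((C.erase x).filter fun y => inner ℝ x y = s).card
        + ((C.erase x).filter fun y => inner ℝ x y = -b).card + 1 = C.card ∧
    1 - (((C.erase x).filter fun y => inner ℝ x y = -1).card : ℝ)
        + s * ((C.erase x).filter fun y => inner ℝ x y = s).card
        - b * ((C.erase x).filter fun y => inner ℝ x y = -b).card = 0 ∧
    1 + (((C.erase x).filter fun y => inner ℝ x y = -1).card : ℝ)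
        + s ^ 2 * ((C.erase x).filter fun y => inner ℝ x y = s).card
        + b ^ 2 * ((C.erase x).filter fun y => inner ℝ x y = -b).card = (C.card : ℝ) / n := by
  classical
  have hF : ∀ t : ℝ, -1 ≤ t → t ≤ s → ∑ k ∈ range (4 + 1), f k * gegenbauerSum μ k t ≤ 0 := by
    intro t ht1 ht2
    rw [hfac]
    have : (t + 1) * (t - s) ≤ 0 := mul_nonpos_of_nonneg_of_nonpos (by linarith) (by linarith)
    exact mul_nonpos_of_nonpos_of_nonneg this (sq_nonneg _)
  have heq' : (C.card : ℝ) * f 0 = ∑ k ∈ range (4 + 1), f k * gegenbauerSum μ k 1 := by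
    rw [hfac]; rw [heq]; ring
  -- roots
  have hroots : ∀ y ∈ C.erase x, inner ℝ x y = -1 ∨ inner ℝ x y = s ∨ inner ℝ x y = -b := by
    intro y hy
    have hyC : y ∈ C := Finset.mem_of_mem_erase hy
    have hxy : x ≠ y := (Finset.ne_of_mem_erase hy).symm
    have h0 := DelsarteLP.sum_eq_zero_of_card_mul_eq hnμ hμ 4 f hf s hF C h1 h2 heq' hx hyC hxy
    rw [hfac] at h0
    rcases mul_eq_zero.1 h0 with h | h
    · rcases mul_eq_zero.1 h with h' | h'
      · left; linarith
      · right; left; linarith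
    · right; right
      have := pow_eq_zero_iff (n := 2) (by norm_num) |>.1 h
      linarith
  -- balanced and 2-design identities
  have hbal : ∑ y ∈ C, inner ℝ x y = 0 :=
    sum_inner_eq_zero_of_card_mul_eq hnμ hμ 4 f hf s hF C h1 h2 heq' (by norm_num) hf1 x
  have hdes : ∑ y ∈ C, inner ℝ x y ^ 2 = (C.card : ℝ) / n :=
    sum_inner_sq_eq_of_card_mul_eq hnμ hμ 4 f hf s hF C h1 h2 heq' (by norm_num) hf2 hx
  -- bookkeeping
  set P := (C.erase x).filter fun y => inner ℝ x y = -1 with hP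
  set Q := (C.erase x).filter fun y => inner ℝ x y = s with hQ
  set R := (C.erase x).filter fun y => inner ℝ x y = -b with hR
  have hs1' : s ≠ -1 := by linarith
  -- antipode count ≤ 1
  have hPle : P.card ≤ 1 := by
    refine Finset.card_le_one.2 fun y hy z hz => ?_
    have hy' := Finset.mem_filter.1 hy
    have hz' := Finset.mem_filter.1 hz
    have hyC := Finset.mem_of_mem_erase hy'.1
    have hzC := Finset.mem_of_mem_erase hz'.1
    rw [eq_neg_of_inner_eq_neg_one (h1 x hx) (h1 y hyC) hy'.2,
      eq_neg_of_inner_eq_neg_one (h1 x hx) (h1 z hzC) hz'.2]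
  -- the three classes partition `C.erase x`
  have hQR : Q ∪ R = (C.erase x).filter fun y => ¬ inner ℝ x y = -1 := by
    ext y
    simp only [hQ, hR, Finset.mem_union, Finset.mem_filter]
    constructor
    · rintro (⟨hy, h⟩ | ⟨hy, h⟩)
      · exact ⟨hy, fun h' => hs1' (h.symm.trans h')⟩
      · refine ⟨hy, fun h' => hb1 ?_⟩
        linarith
    · rintro ⟨hy, h⟩
      rcases hroots y hy with h' | h' | h'
      · exact absurd h' h
      · exact Or.inl ⟨hy, h'⟩
      · exact Or.inr ⟨hy, h'⟩
  have hQRdisj : Disjoint Q R := by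
    rw [hQ, hR, Finset.disjoint_filter]
    intro y _ h h'
    exact hsb (h.symm.trans h')
  have hcardQR : (Q ∪ R).card = Q.card + R.card := Finset.card_union_of_disjoint hQRdisj
  have hcard : P.card + (Q.card + R.card) = (C.erase x).card := by
    rw [← hcardQR, hQR, hP]
    exact Finset.card_filter_add_card_filter_not _
  have hcardC : (C.erase x).card + 1 = C.card := Finset.card_erase_add_one hx
  have hxx : inner ℝ x x = 1 := by
    rw [real_inner_self_eq_norm_sq, h1 x hx, one_pow]
  -- sums of `g (inner x y)` over `C.erase x` split along the partition
  have hsum : ∀ g : ℝ → ℝ, ∑ y ∈ C.erase x, g (inner ℝ x y) =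
      (P.card : ℝ) * g (-1) + (Q.card : ℝ) * g s + (R.card : ℝ) * g (-b) := by
    intro g
    rw [← Finset.sum_filter_add_sum_filter_not (C.erase x) (fun y => inner ℝ x y = -1), ← hP, ← hQR,
      Finset.sum_union hQRdisj]
    have eP : ∑ y ∈ P, g (inner ℝ x y) = (P.card : ℝ) * g (-1) := by
      rw [Finset.sum_congr rfl fun y hy => by rw [(Finset.mem_filter.1 hy).2], Finset.sum_const,
        nsmul_eq_mul]
    have eQ : ∑ y ∈ Q, g (inner ℝ x y) = (Q.card : ℝ) * g s := by
      rw [Finset.sum_congr rfl fun y hy => by rw [(Finset.mem_filter.1 hy).2], Finset.sum_const,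
        nsmul_eq_mul]
    have eR : ∑ y ∈ R, g (inner ℝ x y) = (R.card : ℝ) * g (-b) := by
      rw [Finset.sum_congr rfl fun y hy => by rw [(Finset.mem_filter.1 hy).2], Finset.sum_const,
        nsmul_eq_mul]
    rw [eP, eQ, eR]; ring
  have hbal' : 1 + ((P.card : ℝ) * (-1) + (Q.card : ℝ) * s + (R.card : ℝ) * (-b)) = 0 := by
    have := hbal
    rw [← Finset.add_sum_erase C _ hx, hxx, hsum (fun u => u)] at this
    exact this
  have hdes' : 1 + ((P.card : ℝ) * (-1) ^ 2 + (Q.card : ℝ) * s ^ 2 + (R.card : ℝ) * (-b) ^ 2) =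
      (C.card : ℝ) / n := by
    have := hdes
    rw [← Finset.add_sum_erase C _ hx, hxx, one_pow, hsum (fun u => u ^ 2)] at this
    exact this
  refine ⟨hPle, by omega, by linarith, ?_⟩
  have e : ((-b) ^ 2 : ℝ) = b ^ 2 := by ring
  rw [e] at hdes'
  linarith

/-- **No code attains a sharp quartic certificate whose valency equations have no solution in
natural numbers.** Under the hypotheses of `degree_four_valency` with `f_0 > 0` and
`N · f_0 = f(1) = 2(1-s)(1+b)²` (`N ≥ 1`): if no `m ≤ 1`, `A`, `B ∈ ℕ` with `m + A + B + 1 = N` satisfy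
both `1 - m + sA - bB = 0` and `1 + m + s²A + b²B = N/n`, then every code with pairwise inner products
`≤ s` has `|C| ≤ N - 1`. (Integrality test; cf. Boyvalenkov–Danev–Landgev 1999 for the even
Levenshtein bounds.) -/
theorem degree_four_card_le_of_no_valency {n : ℕ} {μ : ℝ} (hnμ : (n : ℝ) = 2 * μ + 2) (hμ : 0 < μ)
    (s b : ℝ) (hsb : s ≠ -b) (hb1 : b ≠ 1) (hs1 : -1 < s) (f : ℕ → ℝ) (hf : ∀ k, 0 ≤ f k)
    (hf0 : 0 < f 0) (hf1 : 0 < f 1) (hf2 : 0 < f 2)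
    (hfac : ∀ t : ℝ, ∑ k ∈ range (4 + 1), f k * gegenbauerSum μ k t = (t + 1) * (t - s) * (t + b) ^ 2)
    (N : ℕ) (hN : 1 ≤ N) (hval : (N : ℝ) * f 0 = 2 * (1 - s) * (1 + b) ^ 2)
    (hno : ∀ m A B : ℕ, m ≤ 1 → m + A + B + 1 = N → (1 : ℝ) - m + s * A - b * B = 0 →
      (1 : ℝ) + m + s ^ 2 * A + b ^ 2 * B = (N : ℝ) / n → False)
    (C : Finset (EuclideanSpace ℝ (Fin n)))
    (h1 : ∀ x ∈ C, ‖x‖ = 1) (h2 : ∀ x ∈ C, ∀ y ∈ C, x ≠ y → inner ℝ x y ≤ s) :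
    C.card + 1 ≤ N := by
  have hF : ∀ t : ℝ, -1 ≤ t → t ≤ s → ∑ k ∈ range (4 + 1), f k * gegenbauerSum μ k t ≤ 0 := by
    intro t ht1 ht2
    rw [hfac]
    have : (t + 1) * (t - s) ≤ 0 := mul_nonpos_of_nonneg_of_nonpos (by linarith) (by linarith)
    exact mul_nonpos_of_nonpos_of_nonneg this (sq_nonneg _)
  have hle := DelsarteLP.card_mul_le hnμ hμ 4 f hf s hF C h1 h2
  rw [hfac] at hle
  have hle' : (C.card : ℝ) * f 0 ≤ (N : ℝ) * f 0 := by rw [hval]; linarith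
  have hcardle : (C.card : ℝ) ≤ N := le_of_mul_le_mul_right hle' hf0
  have hC : C.card ≤ N := by exact_mod_cast hcardle
  rcases hC.lt_or_eq with hlt | heqN
  · omega
  · exfalso
    obtain ⟨x, hx⟩ := Finset.card_pos.1 (by omega : 0 < C.card)
    have heq : (C.card : ℝ) * f 0 = 2 * (1 - s) * (1 + b) ^ 2 := by rw [heqN]; exact hval
    obtain ⟨hm, hc, hb, hd⟩ :=
      degree_four_valency hnμ hμ s b hsb hb1 hs1 f hf hf1 hf2 hfac C h1 h2 heq hx
    rw [heqN] at hd
    exact hno _ _ _ hm (hc.trans heqN) hb hd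

end Summit.Ventures.PackingBounds.SphericalCodes

end
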